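import Literature.Probability.RandomPlanarGeometry.SLESameSideUpperBound
import Literature.Probability.RandomPlanarGeometry.SameSideHypergeometric
import Literature.Probability.RandomPlanarGeometry.CritPercSLESwallowingLaw
import Literature.Probability.RandomPlanarGeometry.SLETraceContinuity
import HarnessLib

/-!
# Rohde–Schramm's Lemma 6.6: the sharp same-side two-point law, and (6.13) from the trace theorem

Topic `Probability/RandomPlanarGeometry`; theorems only. S. Rohde, O. Schramm, *Basic properties of
SLE*, Ann. of Math. 161 (2005), Lemma 6.6 (p. 908): for `κ ∈ (4, 8)` and `s ≥ 1`,
`P[X ≥ s] = 4^{(κ-4)/κ} √π ₂F₁(1-4/κ, 2-8/κ; 2-4/κ; 1/s) s^{(4-κ)/κ}/(Γ(2-4/κ)Γ(4/κ-1/2))` (6.13),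
`X = inf([1, ∞) ∩ γ[0, ∞))`, vendored as the named fact `sle_measureReal_Ico_disjoint_range_eq`
(`CritPercSLESwallowing`). This file proves its genuine content and pins down exactly what is left:

* `measureReal_swallowingTime_eq_sameSide` — **the sharp same-side two-point law**: for
  `4 < κ < 8` and `0 < y < x`, `P[T_y = T_x] = (h(z₀) - h(1))/(h(∞) - h(1))`, `h = sameSideH (2/κ)`,
  `z₀ = x/(x-y)`, `h(∞) = sameSideHTop (2/κ)`; from the tree's lower bound
  (`measureReal_swallowingTime_eq_ge`, letting the lower level `1 + δ₀ ↓ 1`, `tendsto_sameSideH_one`)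
  and the upper bound `measureReal_swallowingTime_eq_le` (letting the upper level `1 + R ↑ ∞`,
  `tendsto_sameSideH_atTop`);
* `measureReal_swallowingTime_one_eq_rohdeSchramm613` — **for `s ≥ 1`, `P[T_1 = T_s]` is the
  right-hand side of (6.13)** (`sameSide_hittingProb_eq_rohdeSchramm613`, `rohdeSchramm613_at_one`
  for `s = 1`);
* `sle_measureReal_Ico_disjoint_range_eq_iff_hasSLETrace` — hence **the vendored Lemma 6.6 is
  equivalent to the Rohde–Schramm trace theorem on `(4, 8)`** (`HasSLETrace κ` for all
  `κ ∈ (4, 8)`; `sle_measureReal_Ico_disjoint_range_eq_iff` of `CritPercSLESwallowingLaw`), and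
  **follows from Cor. 3.5** (`sle_measureReal_Ico_disjoint_range_eq_of_cor35`, through
  `hasSLETrace_of_ne_eight_of_cor35`), the single remaining named fact behind Thm. 5.1 in the tree.

## References

* S. Rohde, O. Schramm, *Basic properties of SLE*, Ann. of Math. 161 (2005), Lemma 6.6, eq. (6.13),
  Thm 5.1, Cor. 3.5.
* G. F. Lawler, *Conformally Invariant Processes in the Plane*, AMS (2005), Prop. 6.34.
-/

noncomputable section

open MeasureTheory ProbabilityTheory Filter Set Topology
open scoped NNReal ENNReal Real

namespace Literature.Probability.RandomPlanarGeometry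

open Loewner Literature.Probability.Process

variable {κ : ℝ≥0} {x y : ℝ}

/-! ### The sharp two-point law -/

/-- **The sharp same-side two-point law** (Rohde–Schramm (2005), Lemma 6.6; Lawler (2005),
Prop. 6.34): for `4 < κ < 8` and `0 < y < x`,
`P[T_y = T_x] = (h(z₀) - h(1))/(h(∞) - h(1))`, `h = sameSideH (2/κ)`, `z₀ = x/(x-y)`,
`h(∞) = sameSideHTop (2/κ)`. [cite: RohdeSchramm2005, Lemma 6.6] -/
theorem measureReal_swallowingTime_eq_sameSide (hκ4 : 4 < κ) (hκ8 : κ < 8) (hy : 0 < y) (hyx : y < x) :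
    preWienerMeasure.real {ω | swallowingTime (sleDriving κ ω) y = swallowingTime (sleDriving κ ω) x} =
      (sameSideH (2 / (κ : ℝ)) (x / (x - y)) - sameSideH (2 / (κ : ℝ)) 1) /
        (sameSideHTop (2 / (κ : ℝ)) - sameSideH (2 / (κ : ℝ)) 1) := by
  set a : ℝ := 2 / (κ : ℝ) with ha
  set h := sameSideH a with hh
  set B := sameSideHTop a with hB
  set A := sameSideH a 1 with hA
  set p := preWienerMeasure.real {ω | swallowingTime (sleDriving κ ω) y = swallowingTime (sleDriving κ ω) x}
    with hp
  have hκ0 : (0 : ℝ) < κ := by exact_mod_cast lt_trans (by norm_num) hκ4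
  have hκ4' : (4 : ℝ) < κ := by exact_mod_cast hκ4
  have hκ8' : (κ : ℝ) < 8 := by exact_mod_cast hκ8
  have ha4 : 1 / 4 < a := by rw [ha, div_lt_div_iff₀ (by norm_num) hκ0]; linarith
  have ha2 : a < 1 / 2 := by rw [ha, div_lt_div_iff₀ hκ0 (by norm_num)]; linarith
  have hxy : 0 < x - y := by linarith
  have hz₀1 : 1 < x / (x - y) := by rw [one_lt_div hxy]; linarith
  have hAle : ∀ z : ℝ, 1 < z → A ≤ h z := fun z hz ↦ sameSideH_one_le ha2 hz.le
  have hBge : ∀ z : ℝ, 1 < z → h z ≤ B := fun z hz ↦ (sameSideH_lt_sameSideHTop ha4 hz).le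
  have hBA : 0 < B - A := sub_pos.2 (sameSideH_one_lt_sameSideHTop ha4 ha2)
  -- upper bound: `(h(1+R) - A) p ≤ h z₀ - A` for all large `R`, and `h(1+R) → B`
  have hup : (B - A) * p ≤ h (x / (x - y)) - A := by
    have hlim : Tendsto (fun R : ℝ ↦ (h (1 + R) - A) * p) atTop (𝓝 ((B - A) * p)) := by
      refine ((Tendsto.sub_const ?_ A).mul_const p)
      exact (tendsto_sameSideH_atTop ha4).comp (tendsto_atTop_add_const_left _ _ tendsto_id)
    refine le_of_tendsto hlim ?_
    filter_upwards [eventually_gt_atTop (x / (x - y) - 1)] with R hR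
    exact measureReal_swallowingTime_eq_le hκ4 hκ8 hy hyx (by linarith) hAle hBge
  -- lower bound: `h z₀ - h(1+δ₀) ≤ (B - h(1+δ₀)) p` for small `δ₀ > 0`, and `h(1+δ₀) → A`
  have hlow : h (x / (x - y)) - A ≤ (B - A) * p := by
    have hlim1 : Tendsto (fun δ₀ : ℝ ↦ h (1 + δ₀)) (𝓝[>] 0) (𝓝 A) := by
      have h1 : Tendsto (fun δ₀ : ℝ ↦ 1 + δ₀) (𝓝[>] 0) (𝓝[>] 1) := by
        refine tendsto_nhdsWithin_of_tendsto_nhds_of_eventually_within _ ?_ ?_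
        · have : Tendsto (fun δ₀ : ℝ ↦ 1 + δ₀) (𝓝 0) (𝓝 (1 + 0)) :=
            (continuous_const.add continuous_id).tendsto 0
          rw [add_zero] at this
          exact this.mono_left nhdsWithin_le_nhds
        · filter_upwards [self_mem_nhdsWithin] with δ₀ hδ₀
          exact lt_add_of_pos_right 1 (mem_Ioi.1 hδ₀)
      exact (tendsto_sameSideH_one ha2).comp h1
    have hlimL : Tendsto (fun δ₀ : ℝ ↦ h (x / (x - y)) - h (1 + δ₀)) (𝓝[>] 0)
        (𝓝 (h (x / (x - y)) - A)) := hlim1.const_sub _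
    have hlimR : Tendsto (fun δ₀ : ℝ ↦ (B - h (1 + δ₀)) * p) (𝓝[>] 0) (𝓝 ((B - A) * p)) :=
      (hlim1.const_sub B).mul_const p
    haveI : (𝓝[>] (0 : ℝ)).NeBot := nhdsGT_neBot 0
    refine le_of_tendsto_of_tendsto hlimL hlimR ?_
    have hmem : Ioo (0 : ℝ) (x / (x - y) - 1) ∈ 𝓝[>] (0 : ℝ) := Ioo_mem_nhdsGT (by linarith)
    filter_upwards [hmem] with δ₀ hδ₀
    exact measureReal_swallowingTime_eq_ge hκ4 hy hyx hδ₀.1 (by linarith [hδ₀.2]) hBge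
  rw [eq_div_iff hBA.ne']
  linarith

/-! ### `P[T_1 = T_s]` is (6.13) -/

/-- **`P[T_1 = T_s]` is the right-hand side of (6.13)**: for `4 < κ < 8` and `s ≥ 1`,
`P[T_1 = T_s] = 4^{(κ-4)/κ} √π ₂F₁(1-4/κ, 2-8/κ; 2-4/κ; 1/s) s^{(4-κ)/κ}/(Γ(2-4/κ)Γ(4/κ-1/2))`
(`measureReal_swallowingTime_eq_sameSide` at `y = 1`, `x = s`, `z₀ = s/(s-1)`, and
`sameSide_hittingProb_eq_rohdeSchramm613` with `a = 2/κ`; at `s = 1` both sides are `1`,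
`rohdeSchramm613_at_one`). [cite: RohdeSchramm2005, Lemma 6.6, eq. (6.13)] -/
theorem measureReal_swallowingTime_one_eq_rohdeSchramm613 (hκ4 : 4 < κ) (hκ8 : κ < 8) {s : ℝ}
    (hs : 1 ≤ s) :
    preWienerMeasure.real
        {ω | swallowingTime (sleDriving κ ω) 1 = swallowingTime (sleDriving κ ω) s} =
      (4 : ℝ) ^ (((κ : ℝ) - 4) / κ) * Real.sqrt π *
          ₂F₁ (1 - 4 / (κ : ℝ)) (2 - 8 / (κ : ℝ)) (2 - 4 / (κ : ℝ)) (1 / s) *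
          s ^ ((4 - (κ : ℝ)) / κ) /
        (Real.Gamma (2 - 4 / (κ : ℝ)) * Real.Gamma (4 / (κ : ℝ) - 1 / 2)) := by
  haveI := isProbabilityMeasure_preWienerMeasure'
  set a : ℝ := 2 / (κ : ℝ) with ha
  have hκ0 : (0 : ℝ) < κ := by exact_mod_cast lt_trans (by norm_num) hκ4
  have hκ4' : (4 : ℝ) < κ := by exact_mod_cast hκ4
  have hκ8' : (κ : ℝ) < 8 := by exact_mod_cast hκ8
  have ha4 : 1 / 4 < a := by rw [ha, div_lt_div_iff₀ (by norm_num) hκ0]; linarith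
  have ha2 : a < 1 / 2 := by rw [ha, div_lt_div_iff₀ hκ0 (by norm_num)]; linarith
  -- the parameters in terms of `a = 2/κ`
  have e1 : ((κ : ℝ) - 4) / κ = 1 - 2 * a := by rw [ha]; field_simp; ring
  have e2 : 1 - 4 / (κ : ℝ) = 1 - 2 * a := by rw [ha]; ring
  have e3 : 2 - 8 / (κ : ℝ) = 2 - 4 * a := by rw [ha]; ring
  have e4 : 2 - 4 / (κ : ℝ) = 2 - 2 * a := by rw [ha]; ring
  have e5 : (4 - (κ : ℝ)) / κ = 2 * a - 1 := by rw [ha]; field_simp; ring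
  have e6 : 4 / (κ : ℝ) - 1 / 2 = 2 * a - 1 / 2 := by rw [ha]; ring
  rw [e1, e2, e3, e4, e5, e6]
  rcases hs.eq_or_lt with h1 | h1
  · -- `s = 1`: both sides are `1`
    subst h1
    have hset : {ω : ℝ≥0 → ℝ | swallowingTime (sleDriving κ ω) 1 = swallowingTime (sleDriving κ ω) (1 : ℝ)} =
        univ := by
      refine eq_univ_of_forall fun ω ↦ ?_
      simp
    rw [hset, probReal_univ]
    exact (rohdeSchramm613_at_one ha4 ha2).symm
  · have h := measureReal_swallowingTime_eq_sameSide hκ4 hκ8 one_pos h1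
    rw [← ha, Complex.ofReal_one] at h
    rw [h, ← sameSide_hittingProb_eq_rohdeSchramm613 ha4 ha2 h1]

/-! ### Lemma 6.6 ⇔ the trace theorem on `(4, 8)` -/

/-- **The vendored Lemma 6.6 is equivalent to the Rohde–Schramm trace theorem on `(4, 8)`.**
Since its two-point content is now proved (`measureReal_swallowingTime_one_eq_rohdeSchramm613`),
`sle_measureReal_Ico_disjoint_range_eq ↔ ∀ κ ∈ (4, 8), HasSLETrace κ`
(`sle_measureReal_Ico_disjoint_range_eq_iff`). [cite: RohdeSchramm2005, Lemma 6.6 and Thm 5.1] -/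
theorem sle_measureReal_Ico_disjoint_range_eq_iff_hasSLETrace :
    sle_measureReal_Ico_disjoint_range_eq ↔ ∀ ⦃κ : ℝ≥0⦄, 4 < κ → κ < 8 → HasSLETrace κ := by
  rw [sle_measureReal_Ico_disjoint_range_eq_iff]
  constructor
  · exact fun h κ hκ hκ' ↦ (h hκ hκ').1
  · exact fun h κ hκ hκ' ↦ ⟨h hκ hκ', fun s hs ↦
      measureReal_swallowingTime_one_eq_rohdeSchramm613 hκ hκ' hs⟩

/-- **Lemma 6.6 from the trace theorem**: if SLE_κ is generated by a curve for every `κ ∈ (4, 8)`,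
then `sle_measureReal_Ico_disjoint_range_eq` holds. [cite: RohdeSchramm2005, Lemma 6.6] -/
theorem sle_measureReal_Ico_disjoint_range_eq_of_hasSLETrace
    (h : ∀ ⦃κ : ℝ≥0⦄, 4 < κ → κ < 8 → HasSLETrace κ) : sle_measureReal_Ico_disjoint_range_eq :=
  sle_measureReal_Ico_disjoint_range_eq_iff_hasSLETrace.2 h

/-- **Lemma 6.6 from the named fact `hasSLETrace_of_ne_eight`** (RS05 Thm 5.1, `SLE.lean`).
[cite: RohdeSchramm2005, Lemma 6.6 and Thm 5.1] -/
theorem sle_measureReal_Ico_disjoint_range_eq_of_hasSLETrace_of_ne_eight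
    (h : hasSLETrace_of_ne_eight) : sle_measureReal_Ico_disjoint_range_eq :=
  sle_measureReal_Ico_disjoint_range_eq_of_hasSLETrace fun _ _ hκ' ↦ h hκ'.ne

/-- **Lemma 6.6 from Cor. 3.5**: the vendored Lemma 6.6 follows from Rohde–Schramm's one-point
derivative estimate `RohdeSchramm2005_cor35` on the canonical space — the single named fact to
which the tree reduces Thm 5.1 (`hasSLETrace_of_ne_eight_of_cor35`).
[cite: RohdeSchramm2005, Lemma 6.6, Thm 5.1 and Cor. 3.5] -/
theorem sle_measureReal_Ico_disjoint_range_eq_of_cor35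
    (h : RohdeSchramm2005_cor35 Process.preWienerMeasure) : sle_measureReal_Ico_disjoint_range_eq :=
  sle_measureReal_Ico_disjoint_range_eq_of_hasSLETrace_of_ne_eight (hasSLETrace_of_ne_eight_of_cor35 h)

end Literature.Probability.RandomPlanarGeometry
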